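import Summits.HubbardSuperconductivity.HubbardSuperconductivity.Theses.ColourTheSpin
import Literature.MathematicalPhysics.QuantumLattice.SpinGaugedFlatSectorDescent
import Literature.MathematicalPhysics.QuantumLattice.PairFieldEvenSideLRO
import Summits.HubbardSuperconductivity.HubbardSuperconductivity.Theorems.ColourTheSpinSgEndpointStubPureGaugeDictionary
import HarnessLib

/-!
# Stub S1 `stub_bornOppenheimerFlatLimit` of crux `SgEndpoint` (route `ColourTheSpin`,
# item stmt-HubbardSuperconductivity-16272, line `birth`) — landed in named-object form

The skeleton `Cruxes/SgEndpoint/Lines/birth.lean` registers `stub_bornOppenheimerFlatLimit :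
Sig.stub_bornOppenheimerFlatLimit`, whose `Sig` and vocabulary (`CorridorOrderAt`, `IsFlatMinimiser`,
`IsFrozenGroundState`, `frozenHamiltonian`, `frozenPairField`) live in the (non-importable) skeleton. This
file lands the SAME statement with that vocabulary unfolded over the landed Literature objects
(`spinGaugedHubbardTorus`, `spinGaugedPairField`, `SpinGauged.HasParticleNumber`,
`spinGaugedHubbardTorusWith Q8.rep L U 0 0`, `SpinGauged.holonomy`, `Matrix.minEnergyOn`,
`nParticleSubmodule`), registered as the twin stub `stub_bornOppenheimerFlatLimit_unfolded` (the corridor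
antecedent is the route's `let`-text VERBATIM, exactly `CorridorOrderAt` unfolded); the two are
definitionally equal (`spinGaugedHubbardTorus_eq_inline`, `spinGaugedPairField_eq_inline` are `rfl`, and
the skeleton's `sgEndpoint_iff`/`CorridorOrderAt` elaborate to the route text), so the lead closes the
skeleton's S1 by `exact Summit.….Theorems.SgEndpoint.stub_bornOppenheimerFlatLimit_unfolded`.

The mathematics is the Literature theorem `SpinGauged.q8_flatSector_descent`
(`SpinGaugedFlatSectorDescent`: energy sandwich `E_g ≤ e⋆ + g² c_E`, non-flat weight and flat defect
`O(g²)`, compactness of the unit block sector along `g_n → 0⁺`, block decomposition of `Δ^g†Δ^g`, sector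
variational principle). Also recorded: the crux is implied by the failure of the route's target
(`sgEndpoint_of_not_sgCorridorOrder`: `SgEndpoint` quantifies the corridor hypothesis universally, so it
holds vacuously unless corridor order holds at some parameters) and by the pointwise summit matrix
(`sgEndpoint_of_forall_matrix`).
-/

namespace Summit.HubbardSuperconductivity.HubbardSuperconductivity.Theorems.SgEndpoint

set_option linter.dupNamespace false -- summit = problem name (single-conjunct summit), D-0017
set_option linter.style.longLine false -- the registered stub signature is ONE line; the gate matches the header verbatim

open Matrix Literature.MathematicalPhysics.QuantumLattice
open Summit.HubbardSuperconductivity.HubbardSuperconductivity.Theses.ColourTheSpin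

/-- **Stub S1 (`stub_bornOppenheimerFlatLimit`, unfolded twin `stub_bornOppenheimerFlatLimit_unfolded`) —
the Born–Oppenheimer descent to the flat `Q₈` sector.** Under the corridor antecedent at
`(U, δ, g₀, c', L₁)`: for every even `L ≥ L₁` there are a flat configuration `k` minimising the
`N_L`-block frozen ground energy among flat configurations and an `N_L`-block ground state `φ` of
`H_F(k)` whose frozen transported pair order is `≥ c'·L⁴·‖φ‖²`. Proof: `SpinGauged.q8_flatSector_descent`. -/
theorem stub_bornOppenheimerFlatLimit_unfolded : ∀ (U δ g₀ c' : ℝ) (L₁ : ℕ), 0 < U → δ ∈ Set.Ioo (0 : ℝ) (1 / 2) → 0 < g₀ → 0 < c' → (open Literature.MathematicalPhysics.QuantumLattice in ∀ g : ℝ, 0 < g → g ≤ g₀ → ∀ (L : ℕ) [NeZero L], L₁ ≤ L → Even L → (let m : Fin 2 × ZMod 4 → Fin 2 × ZMod 4 → Fin 2 × ZMod 4 := fun u v => (u.1 + v.1, if u.1 = 0 then (if v.1 = 0 then u.2 + v.2 else v.2 - u.2) else if v.1 = 0 then u.2 + v.2 else 2 + v.2 - u.2); let iv : Fin 2 ×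 ZMod 4 → Fin 2 × ZMod 4 := fun u => (u.1, if u.1 = 0 then -u.2 else u.2 + 2); let r : Fin 2 × ZMod 4 → Fin 2 → Fin 2 → ℂ := fun u σ τ => if u.1 = 0 then (if σ = τ then (if σ = 0 then Complex.I else -Complex.I) ^ u.2.val else 0) else if σ = τ then 0 else if σ = 0 then -(-Complex.I) ^ u.2.val else Complex.I ^ u.2.val; let hop := ∑ b : GaugedHubbard.Bond L, ∑ σ : Fin 2, ∑ τ : Fin 2, Matrix.kroneckerMap (· * ·) (creation (orb b.1 σ) * annihilation (orb (b.1.shift b.2) τ)) (Matrix.diagonal fun k : GaugedHubbard.Bond L → Fin 2 × ZMod 4 => r (k b) σ τ); let H := -(hop + hopᴴ) + ((U : ℝ) : ℂ) • Matrix.kroneckerMap (· * ·) (∑ x : FermionTorus 2 L, numberOp x 0 * numberOp x 1) (1 : Matrix (GaugedHubbard.Bond L → Fin 2 × ZMod 4) (GaugedHubbard.Bond L → Fin 2 × ZMod 4) ℂ) + ((g ^ 2 : ℝ) : ℂ) • Matrix.kroneckerMap (· * ·) (1 : Matrix (Finset (Orb (FermionTorus 2 L))) _ ℂ) (∑ b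 : GaugedHubbard.Bond L, Matrix.of fun k k' : GaugedHubbard.Bond L → Fin 2 × ZMod 4 => if k' = Function.update k b (k' b) then (if k b = k' b then (1 : ℂ) else 0) - 1 / 8 else 0) + ((1 / g ^ 2 : ℝ) : ℂ) • Matrix.kroneckerMap (· * ·) (1 : Matrix (Finset (Orb (FermionTorus 2 L))) _ ℂ) (Matrix.diagonal fun k : GaugedHubbard.Bond L → Fin 2 × ZMod 4 => ∑ x : FermionTorus 2 L, (1 - (r (m (m (m (k (x, 0)) (k (x.shift 0, 1))) (iv (k (x.shift 1, 0)))) (iv (k (x, 1)))) 0 0 + r (m (m (m (k (x, 0)) (k (x.shift 0, 1))) (iv (k (x.shift 1, 0)))) (iv (k (x, 1)))) 1 1) / 2)); let P := ∑ b : GaugedHubbard.Bond L, (if b.2 = 0 then (1 : ℂ) else -1) • ∑ σ : Fin 2, ∑ τ : Fin 2, Matrix.kroneckerMap (· * ·) (annihilation (orb b.1 σ) * annihilation (orb (b.1.shift b.2) τ)) (Matrix.diagonal fun k : GaugedHubbard.Bond L → Fin 2 × ZMod 4 => if σ = 0 then r (k b) 1 τ else -r (k b) 0 τ); let p := fun ik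 : Finset (Orb (FermionTorus 2 L)) × (GaugedHubbard.Bond L → Fin 2 × ZMod 4) => ik.1.card = 2 * ⌊(1 - δ) * (L : ℝ) ^ 2 / 2⌋₊; ∀ ψ : {ik // p ik} → ℂ, (ψ ≠ 0 ∧ ∃ E : ℝ, H.toBlock p p *ᵥ ψ = (E : ℂ) • ψ ∧ ∀ φ : {ik // p ik} → ℂ, E * (star φ ⬝ᵥ φ).re ≤ (star φ ⬝ᵥ H.toBlock p p *ᵥ φ).re) → c' * (L : ℝ) ^ 4 * (star ψ ⬝ᵥ ψ).re ≤ (star ψ ⬝ᵥ (Pᴴ * P).toBlock p p *ᵥ ψ).re)) → ∀ (L : ℕ) [NeZero L], L₁ ≤ L → Even L → ∃ k : GaugedHubbard.Bond L → Q8, ((∀ x : FermionTorus 2 L, SpinGauged.holonomy L k x = 1) ∧ ∀ k' : GaugedHubbard.Bond L → Q8, (∀ x : FermionTorus 2 L, SpinGauged.holonomy L k' x = 1) → (Matrix.of fun s s' => spinGaugedHubbardTorusWith Q8.rep L U 0 0 (s, k) (s', k)).minEnergyOn (nParticleSubmodule (2 * ⌊(1 - δ) * (L : ℝ) ^ 2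 / 2⌋₊) : Submodule ℂ (Fock (Orb (FermionTorus 2 L)))) ≤ (Matrix.of fun s s' => spinGaugedHubbardTorusWith Q8.rep L U 0 0 (s, k') (s', k')).minEnergyOn (nParticleSubmodule (2 * ⌊(1 - δ) * (L : ℝ) ^ 2 / 2⌋₊) : Submodule ℂ (Fock (Orb (FermionTorus 2 L))))) ∧ ∃ φ : Fock (Orb (FermionTorus 2 L)), (φ ∈ (nParticleSubmodule (2 * ⌊(1 - δ) * (L : ℝ) ^ 2 / 2⌋₊) : Submodule ℂ (Fock (Orb (FermionTorus 2 L)))) ∧ φ ≠ 0 ∧ (Matrix.of fun s s' => spinGaugedHubbardTorusWith Q8.rep L U 0 0 (s, k) (s', k)) *ᵥ φ = ((((Matrix.of fun s s' => spinGaugedHubbardTorusWith Q8.rep L U 0 0 (s, k) (s', k)).minEnergyOn (nParticleSubmodule (2 * ⌊(1 - δ) * (L : ℝ) ^ 2 / 2⌋₊) : Submodule ℂ (Fock (Orb (FermionTorus 2 L)))) : ℝ) : ℂ) • φ)) ∧ c' * (L : ℝ) ^ 4 * (star φ ⬝ᵥ φ).re ≤ (star φ ⬝ᵥ ((Matrix.of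 fun s s' => spinGaugedPairField L (s, k) (s', k))ᴴ * (Matrix.of fun s s' => spinGaugedPairField L (s, k) (s', k))) *ᵥ φ).re :=
  SpinGauged.q8_flatSector_descent

/-- **The crux holds vacuously where the target fails**: `SgEndpoint` quantifies its corridor
antecedent over ALL `(U, δ, g₀, c', L₁)`, and `SgCorridorOrder` asserts that antecedent at SOME
parameters; hence `¬ SgCorridorOrder → SgEndpoint`. (So the crux carries content exactly at the
parameters where the route's target holds.) -/
theorem sgEndpoint_of_not_sgCorridorOrder (h : ¬ SgCorridorOrder) : SgEndpoint := by
  intro U δ g₀ c' L₁ hU hδ hg hc hC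
  exact absurd ⟨U, hU, δ, hδ, g₀, hg, c', hc, L₁, hC⟩ h

/-- **The crux follows from the pointwise summit matrix**: if every normalised
`(N_L, S^z = 0)`-sector ground-state sequence of `hubbardTorus 2 L 1 U` has `d`-wave pair-field
long-range order for every `U > 0`, `δ ∈ (0, 1/2)`, then `SgEndpoint` (its consequent) holds. -/
theorem sgEndpoint_of_forall_matrix
    (h : ∀ (U δ : ℝ), 0 < U → δ ∈ Set.Ioo (0 : ℝ) (1 / 2) →
      ∀ (N : ℕ → ℕ) (ψ : ∀ L, Fock (Orb (FermionTorus 2 L))),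
        (∀ L, Even L → N L = 2 * ⌊(1 - δ) * (L : ℝ) ^ 2 / 2⌋₊ ∧ star (ψ L) ⬝ᵥ ψ L = 1 ∧
            IsGroundStateInSector (hubbardTorus 2 L 1 U) (N L) 0 (ψ L)) →
          Literature.Probability.LatticeModels.HasLongRangeOrder
            (fun k => Literature.Probability.LatticeModels.halfOpenBox 2 (2 * k))
            (fun k => torusPullback (pairFieldCorr dWaveFormFactor ψ) (2 * k))) :
    SgEndpoint := by
  intro U δ g₀ c' L₁ hU hδ _ _ _
  exact h U δ hU hδ


/-! ## The line's composition in the tree (appended 2026-08-17): `SgEndpoint` from the two remaining stubs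

With S1 (`stub_bornOppenheimerFlatLimit_unfolded`, this file) and S3
(`Summit.HubbardSuperconductivity.ColourTheSpin.SgEndpoint.stub_pureGaugeDictionary`, landed by the sibling
seat in `ColourTheSpinSgEndpointStubPureGaugeDictionary`) in the tree, the crux is reduced — kernel-checked
here, not only in the skeleton — to the CONCLUSIONS of the two remaining registered stubs at the corridor's
parameters: S2 (trivial-twist selection: flat minimisers are pure gauge) and S4 (some ⇒ every ground-state
order). This also certifies that the landed forms of S1 and S3 compose (S1's flat minimiser and frozen
ground state feed S3 verbatim). The hypotheses are the stubs' statements over the named objects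
(`Sig.stub_trivialTwistSelection`, `Sig.stub_someToEveryGroundState` unfolded; definitionally those). -/

section Composition

open Literature.Probability.LatticeModels

/-- **Pointwise composition.** At corridor parameters `(U, δ, g₀, c', L₁)`: corridor order (named form),
trivial-twist selection at `(U, δ)` (S2's conclusion) and the some ⇒ every upgrade at `(U, δ)` (S4's
conclusion) give the summit's matrix at `(U, δ)`: S1 supplies, for every large even `L`, a flat minimiser
`k` with an ordered frozen ground state; S2 makes `k` pure gauge; S3 turns it into a normalised
`(N_L, S^z = 0)`-sector ground state of `hubbardTorus 2 L 1 U` with `Re⟨Δ†Δ⟩ ≥ c'L⁴`; S4 upgrades SOME to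
EVERY ground state; `hasLongRangeOrder_even_of_le` + `sum_pairFieldCorr_succ` close. -/
theorem sectorLRO_of_corridor_of_twistFloor_of_someToEvery (U δ g₀ c' : ℝ) (L₁ : ℕ) (hU : 0 < U)
    (hδ : δ ∈ Set.Ioo (0 : ℝ) (1 / 2)) (hg : 0 < g₀) (hc : 0 < c')
    (hC : ∀ g : ℝ, 0 < g → g ≤ g₀ → ∀ (L : ℕ) [NeZero L], L₁ ≤ L → Even L → ∀ ψ : {ik : SpinGauged.Index L Q8 // SpinGauged.HasParticleNumber L (2 * ⌊(1 - δ) * (L : ℝ) ^ 2 / 2⌋₊) ik} → ℂ, (ψ ≠ 0 ∧ ∃ E : ℝ, (spinGaugedHubbardTorus L U g).toBlock (SpinGauged.HasParticleNumber L (2 * ⌊(1 - δ) * (L : ℝ) ^ 2 / 2⌋₊)) (SpinGauged.HasParticleNumber L (2 * ⌊(1 - δ) * (L : ℝ) ^ 2 / 2⌋₊)) *ᵥ ψ = (E : ℂ) • ψ ∧ ∀ φ : {ik : SpinGauged.Index L Q8 // SpinGauged.HasParticleNumber L (2 * ⌊(1 - δ) * (L : ℝ) ^ 2 / 2⌋₊)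 ik} → ℂ, E * (star φ ⬝ᵥ φ).re ≤ (star φ ⬝ᵥ (spinGaugedHubbardTorus L U g).toBlock (SpinGauged.HasParticleNumber L (2 * ⌊(1 - δ) * (L : ℝ) ^ 2 / 2⌋₊)) (SpinGauged.HasParticleNumber L (2 * ⌊(1 - δ) * (L : ℝ) ^ 2 / 2⌋₊)) *ᵥ φ).re) → c' * (L : ℝ) ^ 4 * (star ψ ⬝ᵥ ψ).re ≤ (star ψ ⬝ᵥ ((spinGaugedPairField L)ᴴ * spinGaugedPairField L).toBlock (SpinGauged.HasParticleNumber L (2 * ⌊(1 - δ) * (L : ℝ) ^ 2 / 2⌋₊)) (SpinGauged.HasParticleNumber L (2 * ⌊(1 - δ) * (L : ℝ) ^ 2 / 2⌋₊)) *ᵥ ψ).re)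
    (h2 : ∃ L₂ : ℕ, ∀ (L : ℕ) [NeZero L], L₂ ≤ L → Even L → ∀ k : GaugedHubbard.Bond L → Q8, ((∀ x : FermionTorus 2 L, SpinGauged.holonomy L k x = 1) ∧ ∀ k' : GaugedHubbard.Bond L → Q8, (∀ x : FermionTorus 2 L, SpinGauged.holonomy L k' x = 1) → (Matrix.of fun s s' => spinGaugedHubbardTorusWith Q8.rep L U 0 0 (s, k) (s', k)).minEnergyOn (nParticleSubmodule (2 * ⌊(1 - δ) * (L : ℝ) ^ 2 / 2⌋₊) : Submodule ℂ (Fock (Orb (FermionTorus 2 L)))) ≤ (Matrix.of fun s s' => spinGaugedHubbardTorusWith Q8.rep L U 0 0 (s, k') (s', k')).minEnergyOn (nParticleSubmodule (2 * ⌊(1 - δ) * (L : ℝ) ^ 2 / 2⌋₊) : Submodule ℂ (Fock (Orb (FermionTorus 2 L))))) → (∃ h : FermionTorus 2 L → Q8, ∀ b : GaugedHubbard.Bond L, k b = h b.1 * (h (b.1.shift b.2))⁻¹))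
    (h4 : ∀ (a : ℝ) (L₂ : ℕ), 0 < a → (∀ (L : ℕ) [NeZero L], L₂ ≤ L → Even L → ∃ ψ : Fock (Orb (FermionTorus 2 L)), star ψ ⬝ᵥ ψ = 1 ∧ IsGroundStateInSector (hubbardTorus 2 L 1 U) (2 * ⌊(1 - δ) * (L : ℝ) ^ 2 / 2⌋₊) 0 ψ ∧ a * (L : ℝ) ^ 4 ≤ (expect ((pairField dWaveFormFactor L)ᴴ * pairField dWaveFormFactor L) ψ).re) → ∃ a' : ℝ, 0 < a' ∧ ∃ L₃ : ℕ, (∀ (L : ℕ) [NeZero L], L₃ ≤ L → Even L → ∀ ψ : Fock (Orb (FermionTorus 2 L)), star ψ ⬝ᵥ ψ = 1 → IsGroundStateInSector (hubbardTorus 2 L 1 U) (2 * ⌊(1 - δ) * (L : ℝ) ^ 2 / 2⌋₊) 0 ψ → a' * (L : ℝ) ^ 4 ≤ (expect ((pairField dWaveFormFactor L)ᴴ * pairField dWaveFormFactor L) ψ).re)) :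
    ∀ (Nf : ℕ → ℕ) (ψ : ∀ L, Fock (Orb (FermionTorus 2 L))), (∀ L, Even L → Nf L = 2 * ⌊(1 - δ) * (L : ℝ) ^ 2 / 2⌋₊ ∧ star (ψ L) ⬝ᵥ ψ L = 1 ∧ IsGroundStateInSector (hubbardTorus 2 L 1 U) (Nf L) 0 (ψ L)) → Literature.Probability.LatticeModels.HasLongRangeOrder (fun k => Literature.Probability.LatticeModels.halfOpenBox 2 (2 * k)) (fun k => torusPullback (pairFieldCorr dWaveFormFactor ψ) (2 * k)) := by
  classical
  obtain ⟨L₂, hsel⟩ := h2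
  -- SOME-ground-state order with the corridor's constant from side `max L₁ (max L₂ 3)` on
  have hsome : ∀ (L : ℕ) [NeZero L], max L₁ (max L₂ 3) ≤ L → Even L → ∃ ψ : Fock (Orb (FermionTorus 2 L)), star ψ ⬝ᵥ ψ = 1 ∧ IsGroundStateInSector (hubbardTorus 2 L 1 U) (2 * ⌊(1 - δ) * (L : ℝ) ^ 2 / 2⌋₊) 0 ψ ∧ c' * (L : ℝ) ^ 4 ≤ (expect ((pairField dWaveFormFactor L)ᴴ * pairField dWaveFormFactor L) ψ).re := by
    intro L _ hL hE
    have hL₁ : L₁ ≤ L := le_trans (le_max_left _ _) hL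
    have hL₂ : L₂ ≤ L := le_trans ((le_max_left _ _).trans (le_max_right _ _)) hL
    have hL3 : 3 ≤ L := le_trans ((le_max_right _ _).trans (le_max_right _ _)) hL
    obtain ⟨k, hmin, φ, hφ, hord⟩ :=
      stub_bornOppenheimerFlatLimit_unfolded U δ g₀ c' L₁ hU hδ hg hc hC L hL₁ hE
    have hpure := hsel L hL₂ hE k hmin
    have hN : Even (2 * ⌊(1 - δ) * (L : ℝ) ^ 2 / 2⌋₊) := even_two_mul _
    exact Summit.HubbardSuperconductivity.ColourTheSpin.SgEndpoint.stub_pureGaugeDictionary L hL3 U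
      (c' * (L : ℝ) ^ 4) _ hN k hpure φ hφ hord
  obtain ⟨a, ha, L₃, hall⟩ := h4 c' _ hc hsome
  intro Nf ψ hadm
  refine hasLongRangeOrder_even_of_le dWaveFormFactor ψ (fun n hn => (hadm (n + 1) hn).2.1) ha L₃
    (fun n hn hK => ?_)
  rw [sum_pairFieldCorr_succ dWaveFormFactor ψ n]
  obtain ⟨hNn, hnorm, hgs⟩ := hadm (n + 1) hn
  rw [hNn] at hgs
  exact hall (n + 1) hK hn (ψ (n + 1)) hnorm hgs

/-- **`SgEndpoint` from the two remaining stubs** (S2 = trivial-twist selection, S4 = some ⇒ every,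
each in the unfolded form of its registered `Sig`, corridor antecedent over the named objects): the
line's `SgEndpoint_of` with S1 and S3 discharged by the landed theorems. Conditional on S2 ∧ S4 — both
are the crux's named bets; nothing is credited. -/
theorem sgEndpoint_of_twistFloor_of_someToEvery
    (h2 : ∀ (U δ g₀ c' : ℝ) (L₁ : ℕ), 0 < U → δ ∈ Set.Ioo (0 : ℝ) (1 / 2) → 0 < g₀ → 0 < c' → (∀ g : ℝ, 0 < g → g ≤ g₀ → ∀ (L : ℕ) [NeZero L], L₁ ≤ L → Even L → ∀ ψ : {ik : SpinGauged.Index L Q8 // SpinGauged.HasParticleNumber L (2 * ⌊(1 - δ) * (L : ℝ) ^ 2 / 2⌋₊) ik} → ℂ, (ψ ≠ 0 ∧ ∃ E : ℝ, (spinGaugedHubbardTorus L U g).toBlock (SpinGauged.HasParticleNumber L (2 * ⌊(1 - δ) * (L : ℝ) ^ 2 / 2⌋₊)) (SpinGauged.HasParticleNumber L (2 * ⌊(1 - δ) * (L : ℝ) ^ 2 / 2⌋₊)) *ᵥ ψ = (E : ℂ) • ψ ∧ ∀ φ : {ik : SpinGauged.Index L Q8 // SpinGauged.HasParticleNumber L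 (2 * ⌊(1 - δ) * (L : ℝ) ^ 2 / 2⌋₊) ik} → ℂ, E * (star φ ⬝ᵥ φ).re ≤ (star φ ⬝ᵥ (spinGaugedHubbardTorus L U g).toBlock (SpinGauged.HasParticleNumber L (2 * ⌊(1 - δ) * (L : ℝ) ^ 2 / 2⌋₊)) (SpinGauged.HasParticleNumber L (2 * ⌊(1 - δ) * (L : ℝ) ^ 2 / 2⌋₊)) *ᵥ φ).re) → c' * (L : ℝ) ^ 4 * (star ψ ⬝ᵥ ψ).re ≤ (star ψ ⬝ᵥ ((spinGaugedPairField L)ᴴ * spinGaugedPairField L).toBlock (SpinGauged.HasParticleNumber L (2 * ⌊(1 - δ) * (L : ℝ) ^ 2 / 2⌋₊)) (SpinGauged.HasParticleNumber L (2 * ⌊(1 - δ) * (L : ℝ) ^ 2 / 2⌋₊)) *ᵥ ψ).re) → ∃ L₂ : ℕ, ∀ (L : ℕ) [NeZero L], L₂ ≤ L → Even L → ∀ k : GaugedHubbard.Bond L → Q8, ((∀ x : FermionTorus 2 L, SpinGauged.holonomy L k x = 1) ∧ ∀ k' : GaugedHubbard.Bond L → Q8, (∀ x : FermionTorus 2 L,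 SpinGauged.holonomy L k' x = 1) → (Matrix.of fun s s' => spinGaugedHubbardTorusWith Q8.rep L U 0 0 (s, k) (s', k)).minEnergyOn (nParticleSubmodule (2 * ⌊(1 - δ) * (L : ℝ) ^ 2 / 2⌋₊) : Submodule ℂ (Fock (Orb (FermionTorus 2 L)))) ≤ (Matrix.of fun s s' => spinGaugedHubbardTorusWith Q8.rep L U 0 0 (s, k') (s', k')).minEnergyOn (nParticleSubmodule (2 * ⌊(1 - δ) * (L : ℝ) ^ 2 / 2⌋₊) : Submodule ℂ (Fock (Orb (FermionTorus 2 L))))) → (∃ h : FermionTorus 2 L → Q8, ∀ b : GaugedHubbard.Bond L, k b = h b.1 * (h (b.1.shift b.2))⁻¹))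
    (h4 : ∀ (U δ g₀ c' : ℝ) (L₁ : ℕ), 0 < U → δ ∈ Set.Ioo (0 : ℝ) (1 / 2) → 0 < g₀ → 0 < c' → (∀ g : ℝ, 0 < g → g ≤ g₀ → ∀ (L : ℕ) [NeZero L], L₁ ≤ L → Even L → ∀ ψ : {ik : SpinGauged.Index L Q8 // SpinGauged.HasParticleNumber L (2 * ⌊(1 - δ) * (L : ℝ) ^ 2 / 2⌋₊) ik} → ℂ, (ψ ≠ 0 ∧ ∃ E : ℝ, (spinGaugedHubbardTorus L U g).toBlock (SpinGauged.HasParticleNumber L (2 * ⌊(1 - δ) * (L : ℝ) ^ 2 / 2⌋₊)) (SpinGauged.HasParticleNumber L (2 * ⌊(1 - δ) * (L : ℝ) ^ 2 / 2⌋₊)) *ᵥ ψ = (E : ℂ) • ψ ∧ ∀ φ : {ik : SpinGauged.Index L Q8 // SpinGauged.HasParticleNumber L (2 * ⌊(1 - δ) * (L : ℝ) ^ 2 / 2⌋₊) ik} → ℂ, E * (star φ ⬝ᵥ φ).re ≤ (star φ ⬝ᵥ (spinGaugedHubbardTorus L U g).toBlock (SpinGauged.HasParticleNumber L (2 * ⌊(1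 - δ) * (L : ℝ) ^ 2 / 2⌋₊)) (SpinGauged.HasParticleNumber L (2 * ⌊(1 - δ) * (L : ℝ) ^ 2 / 2⌋₊)) *ᵥ φ).re) → c' * (L : ℝ) ^ 4 * (star ψ ⬝ᵥ ψ).re ≤ (star ψ ⬝ᵥ ((spinGaugedPairField L)ᴴ * spinGaugedPairField L).toBlock (SpinGauged.HasParticleNumber L (2 * ⌊(1 - δ) * (L : ℝ) ^ 2 / 2⌋₊)) (SpinGauged.HasParticleNumber L (2 * ⌊(1 - δ) * (L : ℝ) ^ 2 / 2⌋₊)) *ᵥ ψ).re) → ∀ (a : ℝ) (L₂ : ℕ), 0 < a → (∀ (L : ℕ) [NeZero L], L₂ ≤ L → Even L → ∃ ψ : Fock (Orb (FermionTorus 2 L)), star ψ ⬝ᵥ ψ = 1 ∧ IsGroundStateInSector (hubbardTorus 2 L 1 U) (2 * ⌊(1 - δ) * (L : ℝ) ^ 2 / 2⌋₊) 0 ψ ∧ a * (L : ℝ) ^ 4 ≤ (expect ((pairField dWaveFormFactor L)ᴴ * pairField dWaveFormFactor L) ψ).re) → ∃ a' : ℝ, 0 < a' ∧ ∃ L₃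 : ℕ, (∀ (L : ℕ) [NeZero L], L₃ ≤ L → Even L → ∀ ψ : Fock (Orb (FermionTorus 2 L)), star ψ ⬝ᵥ ψ = 1 → IsGroundStateInSector (hubbardTorus 2 L 1 U) (2 * ⌊(1 - δ) * (L : ℝ) ^ 2 / 2⌋₊) 0 ψ → a' * (L : ℝ) ^ 4 ≤ (expect ((pairField dWaveFormFactor L)ᴴ * pairField dWaveFormFactor L) ψ).re)) :
    SgEndpoint := by
  intro U δ g₀ c' L₁ hU hδ hg hc hC
  exact sectorLRO_of_corridor_of_twistFloor_of_someToEvery U δ g₀ c' L₁ hU hδ hg hc hC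
    (h2 U δ g₀ c' L₁ hU hδ hg hc hC) (h4 U δ g₀ c' L₁ hU hδ hg hc hC)

end Composition

end Summit.HubbardSuperconductivity.HubbardSuperconductivity.Theorems.SgEndpoint
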